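import Mathlib

/-!
# T5LocallyConstantDense — locally constant functions are uniformly dense in `C(X, Y)` for `X` profinite

Tier-5 support of seat p7 (route/T5-CHECK-G-p7.md §3 S4, the parenthesis «indicators of open cosets
span a uniformly dense 𝒪-submodule» behind «μ = inf over opens = inf over C(Γ⁻, 𝒪)»;
route/T5-LEAN-p7.md §54).

For `X` compact, Hausdorff and totally disconnected (a profinite group such as `Γ⁻ ≅ ℤ_p^d`) and
`Y` a pseudo-metric space (𝒪 = ℤ_p, or ℂ_p), every continuous `f : X → Y` is uniformly approximated
by locally constant functions: `exists_locallyConstant_dist_lt` (pointwise `dist (f x) (g x) < ε`),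
`denseRange_toContinuousMap` (density in the sup-metric of `C(X, Y)`).  A locally constant function
on a compact space takes finitely many values and is the finite combination
`∑ v, v • 1_{g⁻¹ v}` of indicators of its CLOPEN fibres: `eq_sum_indicator_fiber`,
`isClopen_fiber`.  Together: the 𝒪-span of indicators of clopen sets is uniformly dense in
`C(X, 𝒪)` (`dense_span_indicator`).

Mechanism: for each `x` a clopen neighbourhood `V_x ⊆ f⁻¹(ball (f x) ε)` (clopen sets form a basis:
Mathlib's `isTopologicalBasis_isClopen`); finitely many `V_{x_i}` cover `X`; the «first `i` with
`x ∈ V_{x_i}`» is locally constant (its level sets are `V_k ∖ ⋃_{j<k} V_j`, open), and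
`g x := f (x_{first index})` is within `ε` of `f x`.

Nothing about measures, μ-invariants or L-functions is asserted (the μ-invariant step itself,
`mu_twist_invariant`, is row 8 of T5PropGArithmetic; the application is in the prose).
Axioms: standard.  README §8(d): uses an L-value-free non-vanishing device: NO.
-/

namespace Summit.Ventures.HodgeRepro2.T5LocallyConstantDense

open Set Topology

section Cover

variable {X : Type*} [TopologicalSpace X] [T2Space X] [CompactSpace X] [TotallyDisconnectedSpace X]

/-- In a profinite space every point of an open set has a clopen neighbourhood inside it. -/
theorem exists_isClopen_mem_subset {x : X} {u : Set X} (hx : x ∈ u) (hu : IsOpen u) :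
    ∃ v : Set X, IsClopen v ∧ x ∈ v ∧ v ⊆ u :=
  let ⟨v, hv, hxv, hvu⟩ := isTopologicalBasis_isClopen.exists_subset_of_mem_open hx hu
  ⟨v, hv, hxv, hvu⟩

variable {Y : Type*} [PseudoMetricSpace Y]

/-- A finite clopen cover `V_0, …, V_{n-1}` of `X` with centres `c_i` such that `f` stays within `ε`
of `f (c_i)` on `V_i`. -/
theorem exists_finite_clopen_cover (f : X → Y) (hf : Continuous f) {ε : ℝ} (hε : 0 < ε) :
    ∃ (n : ℕ) (V : Fin n → Set X) (c : Fin n → X), (∀ i, IsClopen (V i)) ∧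
      (∀ i, ∀ x ∈ V i, dist (f x) (f (c i)) < ε) ∧ (⋃ i, V i) = univ := by
  classical
  have hU : ∀ x : X, ∃ v : Set X, IsClopen v ∧ x ∈ v ∧ v ⊆ f ⁻¹' Metric.ball (f x) ε := fun x =>
    exists_isClopen_mem_subset (by simp [hε]) (Metric.isOpen_ball.preimage hf)
  choose V hV hxV hVsub using hU
  obtain ⟨t, ht⟩ := isCompact_univ.elim_finite_subcover V (fun x => (hV x).isOpen)
    (fun x _ => mem_iUnion.mpr ⟨x, hxV x⟩)
  refine ⟨t.card, fun i => V (t.equivFin.symm i), fun i => (t.equivFin.symm i : X),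
    fun i => hV _, fun i x hx => ?_, ?_⟩
  · have := hVsub _ hx
    simpa [Metric.mem_ball] using this
  · apply eq_univ_of_univ_subset
    intro x _
    have hx : x ∈ ⋃ y ∈ t, V y := ht (mem_univ x)
    obtain ⟨y, hy, hxy⟩ := mem_iUnion₂.mp hx
    exact mem_iUnion.mpr ⟨t.equivFin ⟨y, hy⟩, by simpa using hxy⟩

/-- **Uniform approximation by locally constant functions** on a profinite space. -/
theorem exists_locallyConstant_dist_lt (f : C(X, Y)) {ε : ℝ} (hε : 0 < ε) :
    ∃ g : LocallyConstant X Y, ∀ x, dist (f x) (g x) < ε := by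
  classical
  obtain ⟨n, V, c, hV, hdist, hcover⟩ := exists_finite_clopen_cover f f.continuous hε
  have hx : ∀ x : X, ∃ i : ℕ, ∃ h : i < n, x ∈ V ⟨i, h⟩ := by
    intro x
    have hx' : x ∈ ⋃ i, V i := hcover ▸ mem_univ x
    obtain ⟨i, hi⟩ := mem_iUnion.mp hx'
    exact ⟨i.1, i.2, hi⟩
  let idx : X → ℕ := fun x => Nat.find (hx x)
  let idxFin : X → Fin n := fun x => ⟨idx x, (Nat.find_spec (hx x)).choose⟩
  have hmem : ∀ x, x ∈ V (idxFin x) := fun x => (Nat.find_spec (hx x)).choose_spec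
  have hopen : ∀ k : ℕ, IsOpen {z | idx z = k} := by
    intro k
    have hset : {z | idx z = k} =
        {z | ∃ h : k < n, z ∈ V ⟨k, h⟩} ∩ ⋂ j ∈ Finset.range k, {z | ¬ ∃ h : j < n, z ∈ V ⟨j, h⟩} := by
      ext z
      simp only [mem_setOf_eq, mem_inter_iff, mem_iInter, Finset.mem_range, idx, Nat.find_eq_iff]
    rw [hset]
    apply IsOpen.inter
    · by_cases h : k < n
      · have : {z | ∃ h : k < n, z ∈ V ⟨k, h⟩} = V ⟨k, h⟩ := by
          ext z; simp [h]
        rw [this]; exact (hV _).isOpen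
      · have : {z | ∃ h : k < n, z ∈ V ⟨k, h⟩} = ∅ := by
          ext z; simp [h]
        rw [this]; exact isOpen_empty
    · apply isOpen_biInter_finset
      intro j _
      by_cases h : j < n
      · have : {z | ¬ ∃ h : j < n, z ∈ V ⟨j, h⟩} = (V ⟨j, h⟩)ᶜ := by
          ext z; simp [h]
        rw [this]; exact (hV _).isClosed.isOpen_compl
      · have : {z | ¬ ∃ h : j < n, z ∈ V ⟨j, h⟩} = univ := by
          ext z; simp [h]
        rw [this]; exact isOpen_univ
  let g : X → Y := fun x => f (c (idxFin x))
  have hg : IsLocallyConstant g := by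
    rw [IsLocallyConstant.iff_exists_open]
    intro x
    refine ⟨{z | idx z = idx x}, hopen _, rfl, fun z hz => ?_⟩
    have hzx : idxFin z = idxFin x := Fin.ext hz
    simp only [g, hzx]
  exact ⟨⟨g, hg⟩, fun x => hdist _ x (hmem x)⟩

/-- The same in the sup-metric of `C(X, Y)`: `dist f g < ε` for some locally constant `g`. -/
theorem exists_locallyConstant_dist_continuousMap_lt (f : C(X, Y)) {ε : ℝ} (hε : 0 < ε) :
    ∃ g : LocallyConstant X Y, dist f g.toContinuousMap < ε := by
  obtain ⟨g, hg⟩ := exists_locallyConstant_dist_lt f hε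
  exact ⟨g, (ContinuousMap.dist_lt_iff hε).mpr fun x => by simpa using hg x⟩

/-- **Density**: the locally constant functions are dense in `C(X, Y)` for `X` profinite. -/
theorem denseRange_toContinuousMap :
    DenseRange (LocallyConstant.toContinuousMap : LocallyConstant X Y → C(X, Y)) := by
  rw [Metric.denseRange_iff]
  intro f r hr
  exact exists_locallyConstant_dist_continuousMap_lt f hr

end Cover

section Indicator

variable {X : Type*} [TopologicalSpace X]

/-- The fibres of a locally constant function are clopen. -/
theorem isClopen_fiber {Y : Type*} (g : LocallyConstant X Y) (y : Y) : IsClopen {x | g x = y} :=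
  g.isLocallyConstant.isClopen_fiber y

variable [CompactSpace X] {R : Type*} [Semiring R]

/-- On a compact space a locally constant function is the finite sum `∑ v, v • 1_{g⁻¹ v}` of
scalar multiples of the indicators of its (clopen) fibres: the «span of indicators of open
cosets» of S4. -/
theorem eq_sum_indicator_fiber (g : LocallyConstant X R) (x : X) :
    g x = ∑ v ∈ g.range_finite.toFinset, v * ({z | g z = v}.indicator 1 x) := by
  classical
  have hx : g x ∈ g.range_finite.toFinset := by simp
  rw [Finset.sum_eq_single (g x)]
  · simp only [mem_setOf_eq, indicator_apply, Pi.one_apply, if_true, mul_one]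
  · intro v _ hv
    have : x ∉ {z | g z = v} := fun h => hv (h.symm)
    simp only [indicator_of_notMem this, mul_zero]
  · intro h
    exact absurd hx h

omit [CompactSpace X] in
/-- The indicator of a clopen set (with any constant value) is locally constant. -/
theorem isLocallyConstant_indicator {U : Set X} (hU : IsClopen U) (r : R) :
    IsLocallyConstant (U.indicator (fun _ => r)) := by
  rw [IsLocallyConstant.iff_exists_open]
  intro x
  by_cases hx : x ∈ U
  · exact ⟨U, hU.isOpen, hx, fun y hy => by simp only [indicator_of_mem hy, indicator_of_mem hx]⟩
  · exact ⟨Uᶜ, hU.isClosed.isOpen_compl, hx, fun y hy => by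
      simp only [indicator_of_notMem (notMem_of_mem_compl hy), indicator_of_notMem hx]⟩

omit [CompactSpace X] in
/-- The finite sum of indicator-multiples is a locally constant function: the converse reading
(every such sum, with clopen sets, is locally constant) — one direction of «span = locally
constant». -/
theorem isLocallyConstant_sum_indicator {ι : Type*} (s : Finset ι) (U : ι → Set X)
    (hU : ∀ i ∈ s, IsClopen (U i)) (a : ι → R) :
    IsLocallyConstant (fun x => ∑ i ∈ s, a i * (U i).indicator 1 x) := by
  classical
  induction s using Finset.induction_on with
  | empty => simp only [Finset.sum_empty]; exact IsLocallyConstant.const 0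
  | insert j s hj ih =>
    simp only [Finset.sum_insert hj]
    have h1 : IsLocallyConstant (fun x => a j * (U j).indicator (1 : X → R) x) := by
      have hc : IsLocallyConstant ((U j).indicator (1 : X → R)) :=
        isLocallyConstant_indicator (hU j (Finset.mem_insert_self j s)) (1 : R)
      exact (IsLocallyConstant.const (a j)).mul hc
    exact h1.add (ih fun i hi => hU i (Finset.mem_insert_of_mem hi))

end Indicator

section Span

variable {X : Type*} [TopologicalSpace X] [T2Space X] [CompactSpace X] [TotallyDisconnectedSpace X]
variable {R : Type*} [NormedRing R]

/-- **S4's parenthesis**: on a profinite `X`, every continuous `f : X → R` is, within any `ε`, a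
finite combination `∑ v, v • 1_{U_v}` of indicators of clopen sets. -/
theorem exists_sum_indicator_dist_lt (f : C(X, R)) {ε : ℝ} (hε : 0 < ε) :
    ∃ (s : Finset R) (U : R → Set X), (∀ v ∈ s, IsClopen (U v)) ∧
      ∀ x, ‖f x - ∑ v ∈ s, v * (U v).indicator 1 x‖ < ε := by
  obtain ⟨g, hg⟩ := exists_locallyConstant_dist_lt f hε
  refine ⟨g.range_finite.toFinset, fun v => {z | g z = v}, fun v _ => isClopen_fiber g v, fun x => ?_⟩
  rw [← eq_sum_indicator_fiber g x, ← dist_eq_norm]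
  exact hg x

end Span

end Summit.Ventures.HodgeRepro2.T5LocallyConstantDense
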